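import Mathlib
import Summits.CriticalPhenomena.PercolationContinuityZ3.Theorems.PercNearOneGluingNoHeavyLowerTailMarkovFirstEdge
import Summits.CriticalPhenomena.PercolationContinuityZ3.Theorems.PercNearOneGluingNoHeavyLowerTailCondCILSteinerPath
import HarnessLib

/-!
# `NoHeavyLowerTail` (stmt-CriticalPhenomena-4575) — SPIDERS, uniformly in the number AND lengths of the legs, with
# no reliability hypothesis on the legs (Markov first-edge bound + conditional CIL for Steiner paths)

Seat `prim-cplus-engine` gen 7, 2026-08-19 (`--supports stmt-CriticalPhenomena-4575`).  No definitions, no named facts,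
no sorries.  Sequel of `…MarkovFirstEdge.lean` and `…CondCILSteinerPath.lean`.

SPIDER: observer `o ∉ A`; every non-relay `x ≠ o` with `w(o,x) ≠ 0` starts an injective Steiner path (`hlegs`, stated in
`G` as in `ObserverUnionBoundG.spider_lowerTail_le_pinW`) whose PATH pairs have weight `≤ 1/2` or `= 1`; all pairs at
`o` have weight `≤ 1/2`; `M ≥ μ_w(|π(a)| ≤ j)` on `A` (lightness IN `G`).  Write `v_x := μ_{G∖s(o,x)}(x ↔ A)` (the
attachment probability of the leg start off the pair back to `o`) and `Λ := Σ_{x ≠ o} w(o,x) · v_x`.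

* `spider_term_le_cond` — per neighbour: `α_x · μ_{G∖s(o,x)}(1 ≤ N_x ≤ j) ≤ 24 · w(o,x) · v_x · M`
  (`α_x = −log(1−w(o,x)) ≤ 2 w(o,x)`; `CondCIL.condCIL_steinerPath` in `G ∖ s(o,x)` gives the factor `6 v_x`; one closed
  pair doubles the lightness).
* `spider_lowerTail_le_markov_cond` — for every `λ > 0`:
      `μ_w(1 ≤ N_o ≤ j) ≤ e^{2λ}·μ_w(o ↮ A) + e^{−λ} + (24 M/λ)·Λ`.
* `spider_lowerTail_le_uniform` — if moreover `μ_w(o ↮ A) ≤ e^{−Λ}` (for a spider this HOLDS: the legs are attached off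
  `o` independently, so `μ(o ↮ A) = ∏_x (1 − w(o,x) v_x) ≤ e^{−Λ}`; kept as an explicit hypothesis here), then with
  `λ = Λ/3`:
      **`μ_w(1 ≤ N_o ≤ j) ≤ 2 e^{−Λ/3} + 72 M`**  — uniform in the number of legs, their lengths, `|A|` and the relay side;
  `G`-form; and `e^{−Λ/3} → 0` exactly when `o`'s expected attached weight `Λ → ∞`, i.e. in the near-one regime
  `μ(o ↮ A) → 0` of the crux (for spiders `μ(o ↮ A) ≥ e^{−1.39 Λ}` as well, all `w(o,x) ≤ 1/2`).
This answers LEAD-GEN6 §8 / Q7 ("spiders uniform in `r` AND `L` with connector legs") at the `ε–δ` level, up to the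
weight normalisation `≤ 1/2` (or `= 1` on the legs).
-/

namespace Summit.CriticalPhenomena.PercolationContinuityZ3.Theorems

open MeasureTheory Set
open Literature.Probability.LatticeModels (prodBernoulli)
open Literature.Probability.Percolation

noncomputable section
open Classical

variable {n : ℕ}

namespace MarkovFirstEdge

/-- **Per-neighbour estimate with the conditional CIL.**  `x ≠ o`; all pairs at `o` of weight `≤ 1/2`;
`μ_w(|π(a)| ≤ j) ≤ M` on `A`; spider legs with path pairs `≤ 1/2` or `= 1`.  Then
`α_x · μ_{G∖s(o,x)}(1 ≤ N_x ≤ j) ≤ 24 · w(o,x) · μ_{G∖s(o,x)}(x ↔ A) · M`. [this work] -/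
theorem spider_term_le_cond (w : Sym2 (Fin n) → unitInterval) (A : Finset (Fin n)) (o : Fin n) (j : ℕ) (M : ℝ)
    (hM : 0 ≤ M) (hhalf : ∀ x : Fin n, x ≠ o → (w s(o, x) : ℝ) ≤ 1 / 2)
    (hlightG : ∀ a ∈ A, (prodBernoulli w).real
      {ω : BondConfig (Fin n) | (A.filter fun z => ω ∈ openConn a z).card ≤ j} ≤ M)
    (hlegs : ∀ x : Fin n, x ≠ o → x ∉ A → w s(o, x) ≠ 0 →
      ∃ (k : ℕ) (p : Fin (k + 1) → Fin n), Function.Injective p ∧ p 0 = x ∧ (∀ i, p i ∉ A) ∧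
        (∀ (i : Fin (k + 1)) (v : Fin n), v ∉ A → v ≠ p i → 0 < (w s(p i, v) : ℝ) →
          (v = o ∧ i = 0) ∨ ∃ l : Fin (k + 1), v = p l ∧ (l.val = i.val + 1 ∨ i.val = l.val + 1)) ∧
        (∀ l : Fin k, (w s(p l.castSucc, p l.succ) : ℝ) ≤ 1 / 2 ∨ w s(p l.castSucc, p l.succ) = 1))
    {x : Fin n} (hxo : x ≠ o) :
    (-Real.log (1 - (w s(o, x) : ℝ))) *
        (prodBernoulli (pinW w ({s(o, x)} : Set (Sym2 (Fin n))) ∅)).real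
          {ω : BondConfig (Fin n) | 1 ≤ (A.filter fun a => ω ∈ openConn x a).card ∧
            (A.filter fun a => ω ∈ openConn x a).card ≤ j} ≤
      24 * (w s(o, x) : ℝ) *
        (prodBernoulli (pinW w ({s(o, x)} : Set (Sym2 (Fin n))) ∅)).real
          (⋃ a ∈ A, (openConn x a : Set (BondConfig (Fin n)))) * M := by
  set wx := pinW w ({s(o, x)} : Set (Sym2 (Fin n))) ∅ with hwx
  set v : ℝ := (prodBernoulli wx).real (⋃ a ∈ A, (openConn x a : Set (BondConfig (Fin n)))) with hv
  have hv0 : 0 ≤ v := measureReal_nonneg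
  have hw0 : 0 ≤ (w s(o, x) : ℝ) := (w s(o, x)).2.1
  have hα : -Real.log (1 - (w s(o, x) : ℝ)) ≤ 2 * (w s(o, x) : ℝ) := by
    -- `-log(1-t) ≤ (1-t)⁻¹ - 1 ≤ 2t` for `0 ≤ t ≤ 1/2`
    have hpos : 0 < 1 - (w s(o, x) : ℝ) := by linarith [hhalf x hxo]
    have hlog := Real.log_le_sub_one_of_pos (inv_pos.2 hpos)
    rw [Real.log_inv] at hlog
    have hinv : (1 - (w s(o, x) : ℝ))⁻¹ - 1 ≤ 2 * (w s(o, x) : ℝ) := by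
      rw [inv_eq_one_div, div_sub_one hpos.ne', div_le_iff₀ hpos]
      nlinarith [hhalf x hxo]
    linarith
  have hαnn : 0 ≤ -Real.log (1 - (w s(o, x) : ℝ)) := by
    have := Real.log_nonpos (by linarith [hhalf x hxo] : (0 : ℝ) ≤ 1 - w s(o, x)) (by linarith)
    linarith
  -- lightness in `G ∖ s(o,x)` is at most twice the lightness in `G`
  have hlight2 : ∀ a ∈ A, (prodBernoulli wx).real
      {ω : BondConfig (Fin n) | (A.filter fun z => ω ∈ openConn a z).card ≤ j} ≤ 2 * M := by
    intro a ha
    have h := ObserverUnionBoundG.pinW_single_real_mul_le w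
      {ω : BondConfig (Fin n) | (A.filter fun z => ω ∈ openConn a z).card ≤ j} s(o, x)
    have hw := hhalf x hxo
    have hnn : 0 ≤ (prodBernoulli wx).real
        {ω : BondConfig (Fin n) | (A.filter fun z => ω ∈ openConn a z).card ≤ j} := measureReal_nonneg
    nlinarith [hlightG a ha]
  -- the `G ∖ s(o,x)` lower tail of `x` is at most `6 · v · 2M` (or the weight is `0`)
  have hbad : (prodBernoulli wx).real
      {ω : BondConfig (Fin n) | 1 ≤ (A.filter fun a => ω ∈ openConn x a).card ∧
        (A.filter fun a => ω ∈ openConn x a).card ≤ j} ≤ 6 * v * (2 * M) ∨ w s(o, x) = 0 := by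
    by_cases hw : w s(o, x) = 0
    · exact Or.inr hw
    left
    by_cases hxA : x ∈ A
    · -- a relay neighbour: `v = 1`
      have hv1 : v = 1 := by
        refine le_antisymm measureReal_le_one ?_
        have huniv : (⋃ a ∈ A, (openConn x a : Set (BondConfig (Fin n)))) = Set.univ := by
          refine Set.eq_univ_of_forall fun ω => Set.mem_iUnion₂.2 ⟨x, hxA, ?_⟩
          exact (SimpleGraph.Reachable.refl x : (openGraph ω).Reachable x x)
        rw [hv, huniv, probReal_univ]
      rw [hv1]
      refine (measureReal_mono (fun ω hω => hω.2) (measure_ne_top _ _)).trans ((hlight2 x hxA).trans ?_)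
      linarith
    by_cases hA : A.Nonempty
    · obtain ⟨c, hc, hcmax⟩ := MergeStability.exists_champion (prodBernoulli wx) A hA j
      obtain ⟨k, p, hpinj, hp0, hpA, hpath, hleg⟩ := hlegs x hxo hxA hw
      have hpath' := ObserverUnionBoundG.legs_pinW_of_legs w A o hp0 hpath
      have hleg' : ∀ l : Fin k, (wx s(p l.castSucc, p l.succ) : ℝ) ≤ 1 / 2 ∨ wx s(p l.castSucc, p l.succ) = 1 := by
        intro l
        by_cases hmem : s(p l.castSucc, p l.succ) ∈ ({s(o, x)} : Set (Sym2 (Fin n)))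
        · left; rw [hwx, pinW_apply_of_mem_of_not_mem w hmem (Set.notMem_empty _)]; norm_num
        · rw [hwx, pinW_apply_of_not_mem w ∅ hmem]; exact hleg l
      have key := CondCIL.condCIL_steinerPath A j _ k wx p hpinj hpA hpath' rfl hleg' c hc hcmax
      rw [hp0] at key
      refine key.trans ?_
      have := hlight2 c hc
      nlinarith
    · rw [Finset.not_nonempty_iff_eq_empty] at hA
      have hempty : {ω : BondConfig (Fin n) | 1 ≤ (A.filter fun a => ω ∈ openConn x a).card ∧
          (A.filter fun a => ω ∈ openConn x a).card ≤ j} = ∅ := by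
        ext ω
        simp only [hA, Finset.filter_empty, Finset.card_empty, mem_setOf_eq, mem_empty_iff_false, iff_false,
          not_and, not_le]
        intro h
        exact absurd h (by norm_num)
      rw [hempty, measureReal_empty]
      positivity
  rcases hbad with hle | hw
  · calc (-Real.log (1 - (w s(o, x) : ℝ))) * (prodBernoulli wx).real
          {ω : BondConfig (Fin n) | 1 ≤ (A.filter fun a => ω ∈ openConn x a).card ∧
            (A.filter fun a => ω ∈ openConn x a).card ≤ j}
        ≤ (2 * (w s(o, x) : ℝ)) * (6 * v * (2 * M)) := mul_le_mul hα hle measureReal_nonneg (by positivity)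
      _ = 24 * (w s(o, x) : ℝ) * v * M := by ring
  · have h0 : (w s(o, x) : ℝ) = 0 := by rw [hw]; rfl
    rw [h0, sub_zero, Real.log_one, neg_zero, zero_mul]
    positivity

/-- **Spiders, Markov form with the conditional CIL** (no reliability hypothesis on the legs).  For every `λ > 0`:
`μ_w(1 ≤ N_o ≤ j) ≤ e^{2λ}·μ_w(o ↮ A) + e^{−λ} + (24M/λ)·Σ_{x ≠ o} w(o,x)·μ_{G∖s(o,x)}(x ↔ A)`. [this work] -/
theorem spider_lowerTail_le_markov_cond (w : Sym2 (Fin n) → unitInterval) (A : Finset (Fin n)) (o : Fin n)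
    (ho : o ∉ A) (j : ℕ) (M : ℝ) (hM : 0 ≤ M)
    (hhalf : ∀ x : Fin n, x ≠ o → (w s(o, x) : ℝ) ≤ 1 / 2)
    (hlightG : ∀ a ∈ A, (prodBernoulli w).real
      {ω : BondConfig (Fin n) | (A.filter fun z => ω ∈ openConn a z).card ≤ j} ≤ M)
    (hlegs : ∀ x : Fin n, x ≠ o → x ∉ A → w s(o, x) ≠ 0 →
      ∃ (k : ℕ) (p : Fin (k + 1) → Fin n), Function.Injective p ∧ p 0 = x ∧ (∀ i, p i ∉ A) ∧
        (∀ (i : Fin (k + 1)) (v : Fin n), v ∉ A → v ≠ p i → 0 < (w s(p i, v) : ℝ) →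
          (v = o ∧ i = 0) ∨ ∃ l : Fin (k + 1), v = p l ∧ (l.val = i.val + 1 ∨ i.val = l.val + 1)) ∧
        (∀ l : Fin k, (w s(p l.castSucc, p l.succ) : ℝ) ≤ 1 / 2 ∨ w s(p l.castSucc, p l.succ) = 1))
    (lam : ℝ) (hlam : 0 < lam) :
    (prodBernoulli w).real {ω : BondConfig (Fin n) |
        1 ≤ (A.filter fun a => ω ∈ openConn o a).card ∧ (A.filter fun a => ω ∈ openConn o a).card ≤ j} ≤
      Real.exp (2 * lam) * (prodBernoulli w).real (⋃ a ∈ A, (openConn o a : Set (BondConfig (Fin n))))ᶜ +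
        Real.exp (-lam) +
        (24 * M / lam) * ∑ x ∈ (Finset.univ.filter fun x : Fin n => x ≠ o), (w s(o, x) : ℝ) *
          (prodBernoulli (pinW w ({s(o, x)} : Set (Sym2 (Fin n))) ∅)).real
            (⋃ a ∈ A, (openConn x a : Set (BondConfig (Fin n)))) := by
  have hw1 : ∀ x : Fin n, x ≠ o → (w s(o, x) : ℝ) < 1 := fun x hx => by linarith [hhalf x hx]
  refine (lowerTail_le_markov_firstEdge w A o ho j hw1 lam hlam).trans ?_
  set P := Finset.univ.filter fun x : Fin n => x ≠ o with hP
  have hsum : ∑ x ∈ P, (-Real.log (1 - (w s(o, x) : ℝ))) *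
        (prodBernoulli (pinW w ({s(o, x)} : Set (Sym2 (Fin n))) ∅)).real
          {ω : BondConfig (Fin n) | 1 ≤ (A.filter fun a => ω ∈ openConn x a).card ∧
            (A.filter fun a => ω ∈ openConn x a).card ≤ j} ≤
      ∑ x ∈ P, 24 * (w s(o, x) : ℝ) *
        (prodBernoulli (pinW w ({s(o, x)} : Set (Sym2 (Fin n))) ∅)).real
          (⋃ a ∈ A, (openConn x a : Set (BondConfig (Fin n)))) * M :=
    Finset.sum_le_sum fun x hx => spider_term_le_cond w A o j M hM hhalf hlightG hlegs (Finset.mem_filter.1 hx).2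
  have hrw : ∑ x ∈ P, 24 * (w s(o, x) : ℝ) *
        (prodBernoulli (pinW w ({s(o, x)} : Set (Sym2 (Fin n))) ∅)).real
          (⋃ a ∈ A, (openConn x a : Set (BondConfig (Fin n)))) * M =
      (24 * M) * ∑ x ∈ P, (w s(o, x) : ℝ) *
        (prodBernoulli (pinW w ({s(o, x)} : Set (Sym2 (Fin n))) ∅)).real
          (⋃ a ∈ A, (openConn x a : Set (BondConfig (Fin n)))) := by
    rw [Finset.mul_sum]
    exact Finset.sum_congr rfl fun x _ => by ring
  have h3 : (1 / lam) * ∑ x ∈ P, (-Real.log (1 - (w s(o, x) : ℝ))) *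
        (prodBernoulli (pinW w ({s(o, x)} : Set (Sym2 (Fin n))) ∅)).real
          {ω : BondConfig (Fin n) | 1 ≤ (A.filter fun a => ω ∈ openConn x a).card ∧
            (A.filter fun a => ω ∈ openConn x a).card ≤ j} ≤
      (24 * M / lam) * ∑ x ∈ P, (w s(o, x) : ℝ) *
        (prodBernoulli (pinW w ({s(o, x)} : Set (Sym2 (Fin n))) ∅)).real
          (⋃ a ∈ A, (openConn x a : Set (BondConfig (Fin n)))) := by
    calc (1 / lam) * _ ≤ (1 / lam) * ((24 * M) * ∑ x ∈ P, (w s(o, x) : ℝ) *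
          (prodBernoulli (pinW w ({s(o, x)} : Set (Sym2 (Fin n))) ∅)).real
            (⋃ a ∈ A, (openConn x a : Set (BondConfig (Fin n))))) :=
          mul_le_mul_of_nonneg_left (hsum.trans hrw.le) (by positivity)
      _ = _ := by ring
  linarith

/-- **Spiders, `(r, L)`-uniform form.**  Under the hypotheses of `spider_lowerTail_le_markov_cond`, write
`Λ := Σ_{x ≠ o} w(o,x)·μ_{G∖s(o,x)}(x ↔ A)`.  If `μ_w(o ↮ A) ≤ e^{−Λ}` (true for a spider, whose legs are attached off `o`
independently: `μ(o ↮ A) = ∏_x (1 − w(o,x) v_x) ≤ e^{−Λ}`; kept as a hypothesis) and `Λ > 0`, then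
`μ_w(1 ≤ N_o ≤ j) ≤ 2 e^{−Λ/3} + 72 M`. [this work] -/
theorem spider_lowerTail_le_uniform (w : Sym2 (Fin n) → unitInterval) (A : Finset (Fin n)) (o : Fin n)
    (ho : o ∉ A) (j : ℕ) (M : ℝ) (hM : 0 ≤ M)
    (hhalf : ∀ x : Fin n, x ≠ o → (w s(o, x) : ℝ) ≤ 1 / 2)
    (hlightG : ∀ a ∈ A, (prodBernoulli w).real
      {ω : BondConfig (Fin n) | (A.filter fun z => ω ∈ openConn a z).card ≤ j} ≤ M)
    (hlegs : ∀ x : Fin n, x ≠ o → x ∉ A → w s(o, x) ≠ 0 →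
      ∃ (k : ℕ) (p : Fin (k + 1) → Fin n), Function.Injective p ∧ p 0 = x ∧ (∀ i, p i ∉ A) ∧
        (∀ (i : Fin (k + 1)) (v : Fin n), v ∉ A → v ≠ p i → 0 < (w s(p i, v) : ℝ) →
          (v = o ∧ i = 0) ∨ ∃ l : Fin (k + 1), v = p l ∧ (l.val = i.val + 1 ∨ i.val = l.val + 1)) ∧
        (∀ l : Fin k, (w s(p l.castSucc, p l.succ) : ℝ) ≤ 1 / 2 ∨ w s(p l.castSucc, p l.succ) = 1))
    (Λ : ℝ) (hΛ : 0 < Λ)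
    (hΛdef : ∑ x ∈ (Finset.univ.filter fun x : Fin n => x ≠ o), (w s(o, x) : ℝ) *
        (prodBernoulli (pinW w ({s(o, x)} : Set (Sym2 (Fin n))) ∅)).real
          (⋃ a ∈ A, (openConn x a : Set (BondConfig (Fin n)))) ≤ Λ)
    (hδ : (prodBernoulli w).real (⋃ a ∈ A, (openConn o a : Set (BondConfig (Fin n))))ᶜ ≤ Real.exp (-Λ)) :
    (prodBernoulli w).real {ω : BondConfig (Fin n) |
        1 ≤ (A.filter fun a => ω ∈ openConn o a).card ∧ (A.filter fun a => ω ∈ openConn o a).card ≤ j} ≤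
      2 * Real.exp (-(Λ / 3)) + 72 * M := by
  have h := spider_lowerTail_le_markov_cond w A o ho j M hM hhalf hlightG hlegs (Λ / 3) (by positivity)
  have h1 : Real.exp (2 * (Λ / 3)) * (prodBernoulli w).real (⋃ a ∈ A, (openConn o a : Set (BondConfig (Fin n))))ᶜ ≤
      Real.exp (-(Λ / 3)) := by
    calc Real.exp (2 * (Λ / 3)) * (prodBernoulli w).real (⋃ a ∈ A, (openConn o a : Set (BondConfig (Fin n))))ᶜ
        ≤ Real.exp (2 * (Λ / 3)) * Real.exp (-Λ) := mul_le_mul_of_nonneg_left hδ (Real.exp_pos _).le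
      _ = Real.exp (-(Λ / 3)) := by rw [← Real.exp_add]; ring_nf
  have hsum0 : 0 ≤ ∑ x ∈ (Finset.univ.filter fun x : Fin n => x ≠ o), (w s(o, x) : ℝ) *
      (prodBernoulli (pinW w ({s(o, x)} : Set (Sym2 (Fin n))) ∅)).real
        (⋃ a ∈ A, (openConn x a : Set (BondConfig (Fin n)))) :=
    Finset.sum_nonneg fun x _ => mul_nonneg (w _).2.1 measureReal_nonneg
  have h3 : (24 * M / (Λ / 3)) * ∑ x ∈ (Finset.univ.filter fun x : Fin n => x ≠ o), (w s(o, x) : ℝ) *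
      (prodBernoulli (pinW w ({s(o, x)} : Set (Sym2 (Fin n))) ∅)).real
        (⋃ a ∈ A, (openConn x a : Set (BondConfig (Fin n)))) ≤ 72 * M := by
    calc (24 * M / (Λ / 3)) * _ ≤ (24 * M / (Λ / 3)) * Λ := mul_le_mul_of_nonneg_left hΛdef (by positivity)
      _ = 72 * M := by field_simp; ring
  linarith

end MarkovFirstEdge

end

end Summit.CriticalPhenomena.PercolationContinuityZ3.Theorems
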